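import Literature.MathematicalPhysics.QuantumFieldTheory.Balaban1983to89.B9Eq3153FrakGkBoundTwoWindows
import Literature.MathematicalPhysics.QuantumFieldTheory.Balaban1983to89.B9Eq334GreenkCovariance

/-!
# `Balaban1983to89.B9Eq3153FrakGkGaugeOrbitTwoWindows` — T. Bałaban, *Propagators for lattice gauge theories in a background field*, Commun. Math. Phys. **99**
# (1985) 389–434 [Balaban1985BackgroundPropagators] Thm 3.13's `L²` clause via (3.153) p. 426, (3.126) p. 420, (3.34)–(3.35) p. 396: **THE MASS ROWS OF THE GREEN's
# LETTERS `H_{1,k}Q_kG_k` AND `𝔊_k` AT `k` LEVELS ON PRINT's CLASS (3.35) OF THE ONE-CUBE TORUS** — the two-window theorems of `B9Eq3153FrakGkBoundTwoWindows`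
# ((B3)∕(B4) re-issued) CARRIED ALONG THE GAUGE ORBIT by `B9Eq334GreenkCovariance` ((3.34b) one storey up) with the SAME constants: for `U` two-window-small and
# ANY `S`-valued unitary-type gauge `u`, `‖H_{1,k}(U^u)Q_k(U^u)G_k(U^u)y‖ ≤ C‖y‖` and `‖𝔊_k(U^u)x‖ ≤ C‖x‖`

statement-level skeleton of published theorems with citation tags; proofs where landed; nothing here is a claim about the Yang–Mills mass gap

CITATION HEADER (lean-in-tree rule).  Audit cell `pub-balaban`, sub-cell `t4`, BINDER row NE9; filed by NE9 formalisation-swarm leaf prover 03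
(`b2b-balaban-t4-ne9-formalise-leaf-03`, gen 65), INTENT I-ne9leaf03-g65-8 (the row owner g86's W-5 offer).  Objects BY NAME; nothing re-declared, 0 `def`.

THE PRINT (verbatim).  p. 396 (3.34): *«G(U^u) = R(u)G(U)R(u⁻¹)»*; (3.35): *«there exists a gauge transformation u on □ such that U^u = e^{iηA} …»*; p. 426: *«(3.147),
(3.153) permit us to reduce properties of 𝔓, 𝔊 to the corresponding properties of G′, (Q′G′²Q′*)⁻¹, G₁, (QG₁Q*)⁻¹»*.

WHAT IS PROVED (sorry-free; proof lane — 0 `def`; [folklore] ∃-plumbing).  `∃ α₀ C > 0` BEFORE every binder; for `U : Bond(T_{L^{n+1}m}) → S` (`S ≤ U1` averaging-closed)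
with E162's data, `hRS`, `0 ≤ α ≤ α₀`, `‖U(b) − 1‖ ≤ αη`, `‖U(∂p) − 1‖ ≤ αη²`, `Δ^{(n+1)}_a(U)` symmetric, `Q_{n+1}(U)` onto, and every `S`-valued gauge `u` (`u* = u⁻¹`,
`τ`-central, fibrewise isometric) with any E162 data for `U^u`, any positivity witness and onto-witness at `U^u`:
**`exists_norm_H1kQkG1k_le_gaugeOrbit_twoWindows`**, **`exists_norm_frakGk_le_gaugeOrbit_twoWindows`** (the positivity at `U` needed by the two-window theorem
is READ BACK from the one at `U^u` by `B9Eq334LaplaceAkCovariance.hposk_gaugeU_iff`).  The flat `D`-rows of (B3)∕(B4) are NOT carried (not gauge covariant).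
HONEST SCOPE.  [folklore]; «NE9 ⇐ the named binders»; NE9 NOT PRINTED ∕ NOT PROVED; NOT summit progress (cell pub-balaban: row NE9 WALLED ON A MODEL; spine PROVED 0/9;
rung (B)+1 finite T⁴ — NOT infinite volume, NOT mass gap, NOT Clay; HONEST DEPENDENCY: continuum YM on T⁴ ⇐ BetaPertH ∧ nine spine estimates (0/9 proved); BetaPertH ⇐
(D1) ∧ (D4) ∧ CAP+tail; G-an2-4 gates asym, D1 and NE2/3/4).  NEW file; modifies nothing.  Net new unproved facts: 0.
-/

noncomputable section

open scoped InnerProductSpace ComplexConjugate BigOperators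

namespace Literature.MathematicalPhysics.QuantumFieldTheory.Balaban1983to89.B9Eq3153FrakGkGaugeOrbitTwoWindows

open B4Sect5Torus (TSite)
open B9SectCLatticeCarrier (Bond bpos)
open B11Eq103H1Complex (BondL2K G1LatticeK H1LatticeK frakGLatticeK)
open B9Eq310HessianOperator (adTransportW)
open B9Eq310DeltaPrime (plaqHolU)
open B9Eq315QTorus (perCfg cornerSite)
open B9Eq315QTower (towerP UlevOf)
open B9Eq326OperatorTower (QkW laplaceAk)
open B7Prop1Explicit (U1 Wcx boxVec)
open B7Prop2Explicit (pdev C0 c2' AvgClosed C0_pos c2'_pos)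
open B9Eq328GaugeAction (gaugeU AdA AdW)
open B7Eq43AveragedSmallnessLevelFree (pdev_perCfg_le_of_plaq)
open B9Eq334LaplaceAkCovariance (hposk_gaugeU_iff)
open B9Eq334GreenkCovariance (norm_H1kQkG1k_gaugeU_of_bound norm_frakGk_gaugeU_of_bound)
open B9Eq3153FrakGkBoundTwoWindows (exists_norm_H1k_Qk_G1k_le_twoWindows exists_norm_frakGk_le_twoWindows)

variable {d : ℕ} (L : ℕ) [NeZero L] (hL : 1 ≤ L) (hL2 : 2 ≤ L)
  {𝔸 : Type*} [NormedRing 𝔸] [NormedAlgebra ℂ 𝔸] [CompleteSpace 𝔸] [NormOneClass 𝔸] [StarRing 𝔸] [NormedStarGroup 𝔸] [StarModule ℂ 𝔸]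
  {W : Type*} [NormedAddCommGroup W] [InnerProductSpace ℂ W] [FiniteDimensional ℂ W] (φ : W ≃ₗ[ℂ] 𝔸) {c₀ c₁ : ℝ} (τ : 𝔸 →ₗ[ℂ] ℂ)

omit [NeZero L] in
include hL2 in
/-- The class thresholds below an owner constant. [folklore] -/
private theorem thresholds' {α₁ : ℝ} (hα₁ : 0 < α₁) :
    ∃ T : ℝ, 0 < T ∧ T ≤ α₁ ∧ C0 d * (2 * T) ≤ 1 / 3 ∧ 2 * (2 * T) ≤ c2' d L := by
  have hC0 := C0_pos d
  have hc2 := c2'_pos d L (le_trans (by norm_num) hL2)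
  refine ⟨min α₁ (min (1 / (6 * C0 d)) (c2' d L / 4)), lt_min hα₁ (lt_min (by positivity) (by positivity)), min_le_left _ _, ?_, ?_⟩
  · have hA3 : min α₁ (min (1 / (6 * C0 d)) (c2' d L / 4)) ≤ 1 / (6 * C0 d) := (min_le_right _ _).trans (min_le_left _ _)
    have h := mul_le_mul_of_nonneg_left hA3 hC0.le
    rw [mul_one_div, show C0 d / (6 * C0 d) = 1 / 6 by field_simp] at h
    linarith
  · have hA2 : min α₁ (min (1 / (6 * C0 d)) (c2' d L / 4)) ≤ c2' d L / 4 := (min_le_right _ _).trans (min_le_right _ _)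
    linarith

omit [StarRing 𝔸] [NormedStarGroup 𝔸] [StarModule ℂ 𝔸] in
/-- From the two windows at `α ≤ T` to print's class (52) for the periodic extension at the constant `2T`. [folklore]
[cite: Balaban1985Averaging, (44) p.24, Prop. 2 (52) p.26] -/
private theorem class_of_windows (m : Fin d → ℕ) [∀ i, NeZero (m i)] (n : ℕ) {S : Subgroup 𝔸ˣ} (hS : AvgClosed d L S)
    {U : Bond d (towerP L m (n + 1)) → 𝔸ˣ} (hU : ∀ b, U b ∈ S) {T α η : ℝ} (hT0 : 0 < T) (hηL : η * (L : ℝ) ^ (n + 1) = 1) (hα0 : 0 ≤ α) (hαle : α ≤ T)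
    (hpl : ∀ p : B9SectCLatticeCarrier.Plaq d (towerP L m (n + 1)), ‖(plaqHolU U p : 𝔸) - 1‖ ≤ α * η ^ 2) :
    pdev (perCfg (towerP L m (n + 1)) U) < (2 * T) * (((L : ℝ) ^ (n + 1))⁻¹) ^ 2 := by
  have hη : η = ((L : ℝ) ^ (n + 1))⁻¹ := (inv_eq_of_mul_eq_one_left hηL).symm
  have hL0 : (0 : ℝ) < (L : ℝ) ^ (n + 1) := by
    have h1 : η * (L : ℝ) ^ (n + 1) ≠ 0 := by rw [hηL]; exact one_ne_zero
    rcases lt_trichotomy ((L : ℝ) ^ (n + 1)) 0 with h | h | h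
    · exact absurd h (not_lt.2 (pow_nonneg (Nat.cast_nonneg L) _))
    · exact absurd (by rw [h, mul_zero]) h1
    · exact h
  have hpd : pdev (perCfg (towerP L m (n + 1)) U) ≤ α * η ^ 2 := pdev_perCfg_le_of_plaq (fun b => hS.le_U1 (hU b)) (by positivity) hpl
  refine lt_of_le_of_lt hpd ?_
  rw [hη]
  exact mul_lt_mul_of_pos_right (by linarith) (by positivity)

variable [Fact (0 < c₀)] [Fact (0 < c₁)] {Mφ Mφ' : ℝ} (hMφ : 0 ≤ Mφ) (hMφ' : 0 ≤ Mφ') (hφ : ∀ w, ‖φ w‖ ≤ Mφ * ‖w‖) (hφ' : ∀ X, ‖φ.symm X‖ ≤ Mφ' * ‖X‖)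
  {a : ℝ} (ha : 0 < a) {Cτ : ℝ} (hτC : ∀ X, ‖τ X‖ ≤ Cτ * ‖X‖) (hCτ : 0 ≤ Cτ) {ρw : ℝ} (hρw : 0 ≤ ρw)

include hL2 hMφ hMφ' hφ hφ' ha hτC hCτ hρw

/-- **`‖H_{1,k}(U^u)Q_k(U^u)G_k(U^u)y‖ ≤ C‖y‖` ON THE GAUGE ORBIT OF THE TWO-WINDOW SET** (the first conjunct of the owner's (B3), two-windowed and carried).
[cite: Balaban1985BackgroundPropagators, (3.126) p.420, (3.153) p.426, Thm 3.11 p.416, (3.34)–(3.35) p.396; Balaban1985Variational, (45) p.285] -/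
theorem exists_norm_H1kQkG1k_le_gaugeOrbit_twoWindows :
    ∃ α₀ C : ℝ, 0 < α₀ ∧ 0 < C ∧ ∀ (n : ℕ) (η : ℝ), η * (L : ℝ) ^ (n + 1) = 1 →
      ∀ (c₀ c₁ : ℝ) [Fact (0 < c₀)] [Fact (0 < c₁)], c₀ * ((L : ℝ) ^ (n + 1)) ^ d = c₁ → |η| ^ d / c₀ ≤ ρw →
      ∀ (m : Fin d → ℕ) [∀ i, NeZero (m i)] (U : Bond d (towerP L m (n + 1)) → 𝔸ˣ) (αU : ℕ → ℝ) (hα1 : ∀ j, αU j ≤ 1 / 64)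
        (hU1 : ∀ (j : ℕ) (x : B7Prop1Explicit.Site d) (κ : Fin d), perCfg (towerP L m (j + 1)) (UlevOf L m (n + 1) U j) x κ ∈ U1 𝔸)
        (hreg : ∀ (j : ℕ) (y : TSite d (towerP L m j)) (κ : Fin d) (r : Fin d → Fin L),
          ‖((Wcx L (perCfg (towerP L m (j + 1)) (UlevOf L m (n + 1) U j)) (cornerSite L y) κ (boxVec L r) : 𝔸ˣ) : 𝔸) - 1‖ ≤ αU j)
        {S : Subgroup 𝔸ˣ}, AvgClosed d L S → (∀ b, U b ∈ S) →
      ∀ {α : ℝ}, 0 ≤ α → α ≤ α₀ →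
        (∀ (b : Bond d (towerP L m (n + 1))) (v u : W), ⟪adTransportW φ U b v, u⟫_ℂ = ⟪v, adTransportW φ (fun b => (U b)⁻¹) b u⟫_ℂ) →
        (∀ b, ‖(U b : 𝔸) - 1‖ ≤ α * η) →
        (∀ p : B9SectCLatticeCarrier.Plaq d (towerP L m (n + 1)), ‖(plaqHolU U p : 𝔸) - 1‖ ≤ α * η ^ 2) →
        (laplaceAk L m n φ η U hL αU hα1 hU1 hreg τ (c₀ := c₀) (c₁ := c₁) a).IsSymmetric →
        ∀ (hQ : Function.Surjective (QkW L m n φ U hL αU hα1 hU1 hreg (c₀ := c₀) (c₁ := c₁)))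
          (g : TSite d (towerP L m (n + 1)) → 𝔸ˣ), (∀ x, g x ∈ S) → (∀ x, star (g x : 𝔸) = ((g x)⁻¹ : 𝔸ˣ)) →
        (∀ (x : TSite d (towerP L m (n + 1))) (X : 𝔸), τ (AdA (g x) X) = τ X) →
        (∀ (x : TSite d (towerP L m (n + 1))) (v v' : W), ⟪AdW φ (g x) v, AdW φ (g x) v'⟫_ℂ = ⟪v, v'⟫_ℂ) →
      ∀ (hU1' : ∀ (j : ℕ) (x : B7Prop1Explicit.Site d) (κ : Fin d), perCfg (towerP L m (j + 1)) (UlevOf L m (n + 1) (gaugeU g U) j) x κ ∈ U1 𝔸)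
        (hreg' : ∀ (j : ℕ) (y : TSite d (towerP L m j)) (κ : Fin d) (r : Fin d → Fin L),
          ‖((Wcx L (perCfg (towerP L m (j + 1)) (UlevOf L m (n + 1) (gaugeU g U) j)) (cornerSite L y) κ (boxVec L r) : 𝔸ˣ) : 𝔸) - 1‖ ≤ αU j)
        (hpos' : ∀ x : BondL2K ℂ d (towerP L m (n + 1)) c₀ W, x ≠ 0 →
          0 < RCLike.re ⟪x, laplaceAk L m n φ η (gaugeU g U) hL αU hα1 hU1' hreg' τ (c₀ := c₀) (c₁ := c₁) a x⟫_ℂ)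
        (hQ' : Function.Surjective (QkW L m n φ (gaugeU g U) hL αU hα1 hU1' hreg' (c₀ := c₀) (c₁ := c₁)))
        (y : BondL2K ℂ d (towerP L m (n + 1)) c₀ W),
        ‖H1LatticeK hpos' hQ' (QkW L m n φ (gaugeU g U) hL αU hα1 hU1' hreg' (c₁ := c₁) (G1LatticeK hpos' y))‖ ≤ C * ‖y‖ := by
  obtain ⟨α₁, C, hα₁, hC, H⟩ := exists_norm_H1k_Qk_G1k_le_twoWindows L hL hL2 φ hMφ hMφ' hφ hφ' ha τ hτC hCτ hρw
  obtain ⟨T, hT0, hTle, hT3, hT2⟩ := thresholds' L hL2 (d := d) hα₁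
  refine ⟨T, C, hT0, hC, ?_⟩
  intro n η hηL c₀ c₁ _ _ hw hρ m _ U αU hα1 hU1 hreg S hS hU α hα0 hαle hRS hUη hpl hsymm hQ g hg hstar hτg hAd hU1' hreg' hpos' hQ' y
  have h52 := class_of_windows L m n hS hU hT0 hηL hα0 hαle hpl
  have hT0' : 0 < 2 * T := by positivity
  have hpos := (hposk_gaugeU_iff L m n hL hL2 hS U hU g hg hT0' hT3 hT2 h52 φ τ η αU hα1 hU1 hreg hU1' hreg' hτg hstar hAd a).1 hpos'
  have hB := fun y => (H n η hηL c₀ c₁ hw hρ m U αU hα1 hU1 hreg hS hU hα0 (hαle.trans hTle) hRS hUη hpl hsymm hpos hQ y).1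
  exact norm_H1kQkG1k_gaugeU_of_bound L m n hL hL2 hS U hU g hg hT0' hT3 hT2 h52 φ τ η αU hα1 hU1 hreg hU1' hreg' hτg hstar hAd hpos hpos' hQ hQ' hB y

/-- **`‖𝔊_k(U^u)x‖ ≤ C‖x‖` ON THE GAUGE ORBIT OF THE TWO-WINDOW SET — [B9] THM 3.13's `L²` CLAUSE FOR THE THIRD GREEN's LETTER ON PRINT's CLASS (3.35) OF THE
ONE-CUBE TORUS** (the first conjunct of the owner's (B4), two-windowed and carried; `C = 16∕γ(d,a)` unchanged).
[cite: Balaban1985BackgroundPropagators, Thm 3.13 p.427, (3.153) p.426, Thm 3.11 p.416, (3.34)–(3.35) p.396; Balaban1985Averaging, Prop. 2 (52)–(54) p.26] -/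
theorem exists_norm_frakGk_le_gaugeOrbit_twoWindows :
    ∃ α₀ C : ℝ, 0 < α₀ ∧ 0 < C ∧ ∀ (n : ℕ) (η : ℝ), η * (L : ℝ) ^ (n + 1) = 1 →
      ∀ (c₀ c₁ : ℝ) [Fact (0 < c₀)] [Fact (0 < c₁)], c₀ * ((L : ℝ) ^ (n + 1)) ^ d = c₁ → |η| ^ d / c₀ ≤ ρw →
      ∀ (m : Fin d → ℕ) [∀ i, NeZero (m i)] (U : Bond d (towerP L m (n + 1)) → 𝔸ˣ) (αU : ℕ → ℝ) (hα1 : ∀ j, αU j ≤ 1 / 64)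
        (hU1 : ∀ (j : ℕ) (x : B7Prop1Explicit.Site d) (κ : Fin d), perCfg (towerP L m (j + 1)) (UlevOf L m (n + 1) U j) x κ ∈ U1 𝔸)
        (hreg : ∀ (j : ℕ) (y : TSite d (towerP L m j)) (κ : Fin d) (r : Fin d → Fin L),
          ‖((Wcx L (perCfg (towerP L m (j + 1)) (UlevOf L m (n + 1) U j)) (cornerSite L y) κ (boxVec L r) : 𝔸ˣ) : 𝔸) - 1‖ ≤ αU j)
        {S : Subgroup 𝔸ˣ}, AvgClosed d L S → (∀ b, U b ∈ S) →
      ∀ {α : ℝ}, 0 ≤ α → α ≤ α₀ →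
        (∀ (b : Bond d (towerP L m (n + 1))) (v u : W), ⟪adTransportW φ U b v, u⟫_ℂ = ⟪v, adTransportW φ (fun b => (U b)⁻¹) b u⟫_ℂ) →
        (∀ b, ‖(U b : 𝔸) - 1‖ ≤ α * η) →
        (∀ p : B9SectCLatticeCarrier.Plaq d (towerP L m (n + 1)), ‖(plaqHolU U p : 𝔸) - 1‖ ≤ α * η ^ 2) →
        (laplaceAk L m n φ η U hL αU hα1 hU1 hreg τ (c₀ := c₀) (c₁ := c₁) a).IsSymmetric →
        ∀ (hQ : Function.Surjective (QkW L m n φ U hL αU hα1 hU1 hreg (c₀ := c₀) (c₁ := c₁)))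
          (g : TSite d (towerP L m (n + 1)) → 𝔸ˣ), (∀ x, g x ∈ S) → (∀ x, star (g x : 𝔸) = ((g x)⁻¹ : 𝔸ˣ)) →
        (∀ (x : TSite d (towerP L m (n + 1))) (X : 𝔸), τ (AdA (g x) X) = τ X) →
        (∀ (x : TSite d (towerP L m (n + 1))) (v v' : W), ⟪AdW φ (g x) v, AdW φ (g x) v'⟫_ℂ = ⟪v, v'⟫_ℂ) →
      ∀ (hU1' : ∀ (j : ℕ) (x : B7Prop1Explicit.Site d) (κ : Fin d), perCfg (towerP L m (j + 1)) (UlevOf L m (n + 1) (gaugeU g U) j) x κ ∈ U1 𝔸)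
        (hreg' : ∀ (j : ℕ) (y : TSite d (towerP L m j)) (κ : Fin d) (r : Fin d → Fin L),
          ‖((Wcx L (perCfg (towerP L m (j + 1)) (UlevOf L m (n + 1) (gaugeU g U) j)) (cornerSite L y) κ (boxVec L r) : 𝔸ˣ) : 𝔸) - 1‖ ≤ αU j)
        (hpos' : ∀ x : BondL2K ℂ d (towerP L m (n + 1)) c₀ W, x ≠ 0 →
          0 < RCLike.re ⟪x, laplaceAk L m n φ η (gaugeU g U) hL αU hα1 hU1' hreg' τ (c₀ := c₀) (c₁ := c₁) a x⟫_ℂ)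
        (hQ' : Function.Surjective (QkW L m n φ (gaugeU g U) hL αU hα1 hU1' hreg' (c₀ := c₀) (c₁ := c₁)))
        (x : BondL2K ℂ d (towerP L m (n + 1)) c₀ W), ‖frakGLatticeK hpos' hQ' x‖ ≤ C * ‖x‖ := by
  obtain ⟨α₁, C, hα₁, hC, H⟩ := exists_norm_frakGk_le_twoWindows L hL hL2 φ hMφ hMφ' hφ hφ' ha τ hτC hCτ hρw
  obtain ⟨T, hT0, hTle, hT3, hT2⟩ := thresholds' L hL2 (d := d) hα₁
  refine ⟨T, C, hT0, hC, ?_⟩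
  intro n η hηL c₀ c₁ _ _ hw hρ m _ U αU hα1 hU1 hreg S hS hU α hα0 hαle hRS hUη hpl hsymm hQ g hg hstar hτg hAd hU1' hreg' hpos' hQ' x
  have h52 := class_of_windows L m n hS hU hT0 hηL hα0 hαle hpl
  have hT0' : 0 < 2 * T := by positivity
  have hpos := (hposk_gaugeU_iff L m n hL hL2 hS U hU g hg hT0' hT3 hT2 h52 φ τ η αU hα1 hU1 hreg hU1' hreg' hτg hstar hAd a).1 hpos'
  have hB := fun x => (H n η hηL c₀ c₁ hw hρ m U αU hα1 hU1 hreg hS hU hα0 (hαle.trans hTle) hRS hUη hpl hsymm hpos hQ x).1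
  exact norm_frakGk_gaugeU_of_bound L m n hL hL2 hS U hU g hg hT0' hT3 hT2 h52 φ τ η αU hα1 hU1 hreg hU1' hreg' hτg hstar hAd hpos hpos' hQ hQ' hB x

end Literature.MathematicalPhysics.QuantumFieldTheory.Balaban1983to89.B9Eq3153FrakGkGaugeOrbitTwoWindows

end
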